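import Literature.NumberTheory.Automorphic.ArchEndoscopicChartOrbLocal                 -- ★ p850124 (LH3-p03 (g3)): `chartOrbHLoc`, `chartQuotientMeasureHLoc`, `chartHaarHLoc`, positivity of the box mass
import Literature.NumberTheory.Rogawski1990.ArchLimitFormulaNoncompactWallConstUnique   -- ★ `Literature.MeasureTheory.Group.isOpenPosMeasure_quotientMeasure`
import Literature.NumberTheory.Automorphic.ArchCartanNormalisers                    -- ★ `ArchCartan.one_sub_coe_circleExp_sub_ne_zero_iff` (ED. 2)
import Mathlib.MeasureTheory.Integral.Bochner.ContinuousLinearMap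
import HarnessLib

/-!
# Positivity of the local chart orbital functional and of the `K × N` cone integral on non-negative test functions — (NONDEG-H), local inputs
# (Rogawski 1990 §8.2; Shelstad 1979 §4 Lemma 4.3; Varadarajan 1989 §6.4)

Topic `NumberTheory/Automorphic`; namespace `Literature.NumberTheory.Automorphic` (§1, §3 group-generic) and `….UnitaryGroup` (§2).  THEOREMS ONLY (no definition,
no instance, no notation, no axiom, no named fact, no `sorry`).  Cell `pub/hodgecm-mathlib`, line LH3 (closer stub `stub_N9`, crux H413 = `stmt-HodgeConjecture-24833`);
brick **(β)-2 (N2) «NONDEG-H, local positivity»** (LH3-plan (g3) 2026-09-02T07:19:34Z; census LH5-p04 (g2) 07:30:56Z).  Author LH5-p04 (g2).  Lane `--kind proof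
--supports stmt-HodgeConjecture-24833` (count-neutral).

WHY.  Organ J forces the jump constant `jcH S w₀` by dividing the (K0±) jump by the Cayley value of ONE product test function; ★ `stOrbFamH_insert_cayPt_ne_zero_of_prod`
(p850211) reduces the non-vanishing of that value to the non-vanishing of the per-place limits: at the spectator places the LOCAL CHART ORBITAL FUNCTIONAL ★ `chartOrbHLoc`
(p850124) of the local factor at a regular local point, at the wall place `w₀` the (A0) CONE VALUE `C • ∫_{K×N} f(e^{iθ}·k n k⁻¹)` (★ p850189).  Both are integrals of a
non-negative continuous integrand against a measure charging open sets, hence POSITIVE as soon as the integrand is positive at one point — this file.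

WHAT IS PROVED.
* §1 (generic, any topological group `G`, closed `M ≤ G` centralising `γ₀`, `μ` on `G ⧸ M` charging open sets): `integral_descConj_pos_of_nonneg` — for `f ≥ 0` continuous with
  `descConj γ₀ M f` integrable and `f(x₀ γ₀ x₀⁻¹) ≠ 0` for some `x₀`, `0 < ∫_{G⧸M} f(y γ₀ y⁻¹) dμ`; the `ℂ`-valued reading `integral_descConj_ofReal_ne_zero_of_nonneg`.
* §2 (N2a) `chartOrbHLoc_ofReal_pos_of_nonneg` ∕ `chartOrbHLoc_ofReal_ne_zero_of_nonneg`: for a Haar measure `ν_w` on `U(Φ₂)_w`, `f ≥ 0` continuous on `U(Φ₂)_w` whose orbital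
  integrand at the chart point `endoBlockAt S w cw` has compact support (closed orbit — the regular local points; supplied by the consumer from ★ properness) and is positive at
  one conjugate, `chartOrbHLoc L S w ν_w (f : ℂ-valued) cw` is a POSITIVE REAL (★ `isOpenPosMeasure_quotientMeasure`, ★ `toReal_chartHaarHLoc_chartBoxImgLoc_pos`).
* §3 (N2b) (generic `K, N ≤ G`, `K` compact, `N` closed, `κ`, `μ_N` finite on compacta charging open sets): `hasCompactSupport_prod_conj` — `(k, n) ↦ f(z · k n k⁻¹)` has compact
  support on `K × N` for `f ∈ C_c(G)`; `integral_prod_conj_pos_of_nonneg` — `0 < ∫_{K×N} f(z · k n k⁻¹) d(κ ⊗ μ_N)` for `f ≥ 0` with `f z ≠ 0` (the point `(1, 1)`); the `ℂ`-valued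
  reading `smul_integral_prod_conj_ofReal_ne_zero_of_nonneg` (`C • ∫ … ≠ 0` for `C ≠ 0`) — the shape of the (A0) cone value of ★ `tendsto_abs_sub_smul_integral_descConj_hypBlockGL`.
* §4 (EDITION 2, append-only) the COMPACT spectator factor: `chartOrbHLoc_ofReal_eq_ofReal_nonneg` (for `f ≥ 0` the functional is a non-negative real, unconditionally) and
  `compactFactor_chartOrbHLoc_ofReal_ne_zero_of_nonneg` — `(1 − e^{i(θ₂−θ₀)}) · (chartOrbHLoc … f cw + chartOrbHLoc … f cw^flip) ≠ 0` at a regular compact local point for `f ≥ 0`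
  positive at one conjugate of the chart point (the compact local factor of ★ `archRH_mul_stableSum_eq_mul_prod`).
HONEST LABEL: HC_CM is proved only modulo the 7 printed citations (2 remaining: hLiu418 = stmt-HodgeConjecture-24832, h413 = stmt-HodgeConjecture-24833) until rung 0 closes;
measure-theoretic positivity bookkeeping, pays nothing by itself.

## References
* [Rogawski1990] J. D. Rogawski, *Automorphic Representations of Unitary Groups in Three Variables*, Ann. of Math. Stud. 123 (1990), §8.2 pp. 118–124 (the chart orbital integrals).
* [Shelstad1979] D. Shelstad, *Characters and inner forms of a quasi-split group over ℝ*, Compositio Math. 39 (1979) 11–45, §4 Lemma 4.3 p. 25.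
* [Varadarajan1989] V. S. Varadarajan, *An Introduction to Harmonic Analysis on Semisimple Lie Groups*, Cambridge Stud. Adv. Math. 16 (1989), §6.4 Thm 23 (Rao's cone integral).
* [DeitmarEchterhoff2014] A. Deitmar, S. Echterhoff, *Principles of Harmonic Analysis*, 2nd ed., Thm. 1.5.3 (invariant quotient measures).
-/

set_option autoImplicit false

noncomputable section

open MeasureTheory MeasureTheory.Measure Set Filter Topology Function NumberField NumberField.InfinitePlace
open Literature.MeasureTheory.Group
open scoped ENNReal NNReal

namespace Literature.NumberTheory.Automorphic

/-! ## §1 Generic: the orbital integrand of a non-negative function integrates to a positive number -/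

section Generic

variable {G : Type*} [Group G] [TopologicalSpace G] [IsTopologicalGroup G] (γ₀ : G) (M : Subgroup G) (hM : ∀ m ∈ M, m * γ₀ = γ₀ * m)

/-- **POSITIVITY OF AN ORBITAL INTEGRAL ON A NON-NEGATIVE FUNCTION**: if `f ≥ 0` is continuous, its orbital integrand `y M ↦ f(y γ₀ y⁻¹)` is integrable for a measure `μ` on
`G ⧸ M` charging non-empty open sets, and `f(x₀ γ₀ x₀⁻¹) ≠ 0` for some `x₀`, then `0 < ∫_{G ⧸ M} f(y γ₀ y⁻¹) dμ(y)` (Mathlib `integral_pos_of_integrable_nonneg_nonzero`).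
[cite: DeitmarEchterhoff2014, Thm. 1.5.3] [cite: Rogawski1990, §8.2 p. 122] -/
theorem integral_descConj_pos_of_nonneg [MeasurableSpace (G ⧸ M)] (μ : Measure (G ⧸ M)) [μ.IsOpenPosMeasure]
    {f : G → ℝ} (hf : Continuous f) (h0 : 0 ≤ f) (hint : Integrable (descConj γ₀ M hM f) μ) {x₀ : G} (hx : f (x₀ * γ₀ * x₀⁻¹) ≠ 0) :
    0 < ∫ y, descConj γ₀ M hM f y ∂μ := by
  refine integral_pos_of_integrable_nonneg_nonzero (continuous_descConj γ₀ M hM hf) hint (fun y => ?_) (x := QuotientGroup.mk x₀) ?_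
  · induction y using QuotientGroup.induction_on with
    | H g => exact h0 _
  · rwa [descConj_mk]

/-- The `ℂ`-valued reading: for `f ≥ 0` as above, `∫_{G ⧸ M} (f(y γ₀ y⁻¹) : ℂ) dμ ≠ 0` (it is the positive real `∫ f(y γ₀ y⁻¹) dμ`).
[cite: DeitmarEchterhoff2014, Thm. 1.5.3] -/
theorem integral_descConj_ofReal_ne_zero_of_nonneg [MeasurableSpace (G ⧸ M)] (μ : Measure (G ⧸ M)) [μ.IsOpenPosMeasure]
    {f : G → ℝ} (hf : Continuous f) (h0 : 0 ≤ f) (hint : Integrable (descConj γ₀ M hM f) μ) {x₀ : G} (hx : f (x₀ * γ₀ * x₀⁻¹) ≠ 0) :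
    ∫ y, descConj γ₀ M hM (fun g => ((f g : ℝ) : ℂ)) y ∂μ ≠ 0 := by
  have hcomp : descConj γ₀ M hM (fun g => ((f g : ℝ) : ℂ)) = fun y => ((descConj γ₀ M hM f y : ℝ) : ℂ) := by
    funext y
    induction y using QuotientGroup.induction_on with
    | H g => rfl
  rw [hcomp, integral_complex_ofReal, Complex.ofReal_ne_zero]
  exact (integral_descConj_pos_of_nonneg γ₀ M hM μ hf h0 hint hx).ne'

end Generic

/-! ## §2 (N2a): the local chart orbital functional `chartOrbHLoc` of a non-negative function is a positive real -/

namespace UnitaryGroup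

section LocalPos

variable (L : Type) [Field L] [NumberField L] [IsCMField L] (S : Finset {w : InfinitePlace L // IsComplex w}) (w : {w : InfinitePlace L // IsComplex w})
  [MeasurableSpace ↥(archLocal L 2 (Matrix.of fun i j : Fin 2 => if i.val + j.val + 1 = 2 then (1 : L) else 0) w)]
  [BorelSpace ↥(archLocal L 2 (Matrix.of fun i j : Fin 2 => if i.val + j.val + 1 = 2 then (1 : L) else 0) w)]
  (νw : Measure ↥(archLocal L 2 (Matrix.of fun i j : Fin 2 => if i.val + j.val + 1 = 2 then (1 : L) else 0) w)) [νw.IsHaarMeasure] [νw.IsMulRightInvariant]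

/-- **(N2a) THE LOCAL CHART ORBITAL FUNCTIONAL OF A NON-NEGATIVE FUNCTION IS A POSITIVE REAL.**  For a Haar measure `ν_w` on `U(Φ₂)_w`, `f ≥ 0` continuous on `U(Φ₂)_w` whose
orbital integrand at the chart point `endoBlockAt S w cw` has compact support on `U(Φ₂)_w ⧸ T_{S,w}` (the orbit of a regular local point is closed — supplied by the consumer) and
which is positive at one conjugate `x₀ · endoBlockAt S w cw · x₀⁻¹`: `chartOrbHLoc L S w ν_w f cw = dt_w(B_w) · ∫ f(x·endoBlockAt·x⁻¹) d(ν_w∕dt_w)` read on `(f : ℂ)` equals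
a POSITIVE real number (box mass `> 0`: ★ `toReal_chartHaarHLoc_chartBoxImgLoc_pos`; the quotient measure charges open sets: ★ `isOpenPosMeasure_quotientMeasure`).
[cite: Rogawski1990, §8.2 p. 122] [cite: DeitmarEchterhoff2014, Thm. 1.5.3] -/
theorem chartOrbHLoc_ofReal_eq_ofReal_pos_of_nonneg (cw : Fin 3 → ℝ)
    {f : ↥(archLocal L 2 (Matrix.of fun i j : Fin 2 => if i.val + j.val + 1 = 2 then (1 : L) else 0) w) → ℝ} (hf : Continuous f) (h0 : 0 ≤ f)
    (hsupp : HasCompactSupport (descConj (endoBlockAt L S w cw) (chartTorusHLoc L S w) (forall_mem_chartTorusHLoc_comm L S w cw) f))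
    {x₀ : ↥(archLocal L 2 (Matrix.of fun i j : Fin 2 => if i.val + j.val + 1 = 2 then (1 : L) else 0) w)} (hx : f (x₀ * endoBlockAt L S w cw * x₀⁻¹) ≠ 0) :
    ∃ r : ℝ, 0 < r ∧ chartOrbHLoc L S w νw (fun x => ((f x : ℝ) : ℂ)) cw = (r : ℂ) := by
  letI : MeasurableSpace (↥(archLocal L 2 (Matrix.of fun i j : Fin 2 => if i.val + j.val + 1 = 2 then (1 : L) else 0) w) ⧸ chartTorusHLoc L S w) := borel _
  haveI : BorelSpace (↥(archLocal L 2 (Matrix.of fun i j : Fin 2 => if i.val + j.val + 1 = 2 then (1 : L) else 0) w) ⧸ chartTorusHLoc L S w) := ⟨rfl⟩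
  haveI := locallyCompactSpace_archLocal_two L w
  haveI := secondCountableTopology_archLocal_two L w
  haveI := isHaarMeasure_chartHaarHLoc L S w
  haveI := isInvInvariant_chartHaarHLoc L S w
  -- the quotient measure charges open sets and is finite on compacta
  have hopen : (chartQuotientMeasureHLoc L S w νw).IsOpenPosMeasure := by
    unfold chartQuotientMeasureHLoc
    exact isOpenPosMeasure_quotientMeasure (chartTorusHLoc L S w) (isClosed_chartTorusHLoc L S w) (chartHaarHLoc L S w) νw
  haveI := hopen
  have hreg : (chartQuotientMeasureHLoc L S w νw).Regular := by
    unfold chartQuotientMeasureHLoc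
    infer_instance
  haveI := hreg
  have hint : Integrable (descConj (endoBlockAt L S w cw) (chartTorusHLoc L S w) (forall_mem_chartTorusHLoc_comm L S w cw) f)
      (chartQuotientMeasureHLoc L S w νw) :=
    (continuous_descConj _ _ _ hf).integrable_of_hasCompactSupport hsupp
  have hpos := integral_descConj_pos_of_nonneg (endoBlockAt L S w cw) (chartTorusHLoc L S w) (forall_mem_chartTorusHLoc_comm L S w cw)
    (chartQuotientMeasureHLoc L S w νw) hf h0 hint hx
  refine ⟨(chartHaarHLoc L S w (chartBoxImgLoc L S w)).toReal *
      ∫ y, descConj (endoBlockAt L S w cw) (chartTorusHLoc L S w) (forall_mem_chartTorusHLoc_comm L S w cw) f y ∂(chartQuotientMeasureHLoc L S w νw),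
    mul_pos (toReal_chartHaarHLoc_chartBoxImgLoc_pos L S w) hpos, ?_⟩
  have hcomp : descConj (endoBlockAt L S w cw) (chartTorusHLoc L S w) (forall_mem_chartTorusHLoc_comm L S w cw) (fun x => ((f x : ℝ) : ℂ)) =
      fun y => ((descConj (endoBlockAt L S w cw) (chartTorusHLoc L S w) (forall_mem_chartTorusHLoc_comm L S w cw) f y : ℝ) : ℂ) := by
    funext y
    induction y using QuotientGroup.induction_on with
    | H g => rfl
  rw [chartOrbHLoc_def, hcomp, integral_complex_ofReal, Complex.ofReal_mul]

/-- **(N2a), NON-VANISHING FORM** — the `ℓ w ≠ 0` ∕ `φ w (s w) ≠ 0` input of ★ `stOrbFamH_insert_cayPt_ne_zero_of_prod` at a spectator place: under the hypotheses of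
`chartOrbHLoc_ofReal_eq_ofReal_pos_of_nonneg`, `chartOrbHLoc L S w ν_w (f : ℂ) cw ≠ 0`. [cite: Rogawski1990, §8.2 p. 122] -/
theorem chartOrbHLoc_ofReal_ne_zero_of_nonneg (cw : Fin 3 → ℝ)
    {f : ↥(archLocal L 2 (Matrix.of fun i j : Fin 2 => if i.val + j.val + 1 = 2 then (1 : L) else 0) w) → ℝ} (hf : Continuous f) (h0 : 0 ≤ f)
    (hsupp : HasCompactSupport (descConj (endoBlockAt L S w cw) (chartTorusHLoc L S w) (forall_mem_chartTorusHLoc_comm L S w cw) f))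
    {x₀ : ↥(archLocal L 2 (Matrix.of fun i j : Fin 2 => if i.val + j.val + 1 = 2 then (1 : L) else 0) w)} (hx : f (x₀ * endoBlockAt L S w cw * x₀⁻¹) ≠ 0) :
    chartOrbHLoc L S w νw (fun x => ((f x : ℝ) : ℂ)) cw ≠ 0 := by
  obtain ⟨r, hr, h⟩ := chartOrbHLoc_ofReal_eq_ofReal_pos_of_nonneg L S w νw cw hf h0 hsupp hx
  rw [h, Complex.ofReal_ne_zero]
  exact hr.ne'

/-- **(N2a) WITH THE SHELSTAD FACTOR**: at a SPLIT local point (`cw 0 ≠ 0`) the local factor `|e^{x} − e^{−x}| · chartOrbHLoc … (f : ℂ) cw` of ★ `archRH_mul_stableSum_eq_mul_prod`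
is non-zero under the same hypotheses. [cite: Shelstad1979, §4 p. 22] [cite: Rogawski1990, §8.2 p. 122] -/
theorem absExpSub_mul_chartOrbHLoc_ofReal_ne_zero_of_nonneg (cw : Fin 3 → ℝ) (hcw : cw 0 ≠ 0)
    {f : ↥(archLocal L 2 (Matrix.of fun i j : Fin 2 => if i.val + j.val + 1 = 2 then (1 : L) else 0) w) → ℝ} (hf : Continuous f) (h0 : 0 ≤ f)
    (hsupp : HasCompactSupport (descConj (endoBlockAt L S w cw) (chartTorusHLoc L S w) (forall_mem_chartTorusHLoc_comm L S w cw) f))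
    {x₀ : ↥(archLocal L 2 (Matrix.of fun i j : Fin 2 => if i.val + j.val + 1 = 2 then (1 : L) else 0) w)} (hx : f (x₀ * endoBlockAt L S w cw * x₀⁻¹) ≠ 0) :
    ((|Real.exp (cw 0) - Real.exp (-cw 0)| : ℝ) : ℂ) * chartOrbHLoc L S w νw (fun x => ((f x : ℝ) : ℂ)) cw ≠ 0 := by
  refine mul_ne_zero ?_ (chartOrbHLoc_ofReal_ne_zero_of_nonneg L S w νw cw hf h0 hsupp hx)
  rw [Complex.ofReal_ne_zero, abs_ne_zero, sub_ne_zero]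
  intro h
  have h' : cw 0 = -cw 0 := Real.exp_injective h
  exact hcw (by linarith)

end LocalPos

end UnitaryGroup

/-! ## §3 (N2b): the `K × N` cone integral of a non-negative function is positive -/

section Cone

variable {G : Type*} [Group G] [TopologicalSpace G] [IsTopologicalGroup G]
  (K N : Subgroup G) (hK : IsCompact (K : Set G)) (hN : IsClosed (N : Set G))

include hK hN in
/-- **The `K × N` integrand of a compactly supported function has compact support**: for `f ∈ C_c(G)` (any codomain with `0`) and `z ∈ G`, the function
`(k, n) ↦ f(z · k n k⁻¹)` on `K × N` vanishes off `K × N₀` with `N₀ = N ∩ {k⁻¹ z⁻¹ g k : k ∈ K, g ∈ tsupport f}` compact (`K` compact, `N` closed).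
[cite: Varadarajan1989, §6.4 Thm 23] -/
theorem hasCompactSupport_prod_conj {α : Type*} [TopologicalSpace α] [Zero α] (z : G) {f : G → α} (hfc : HasCompactSupport f) :
    HasCompactSupport fun p : ↥K × ↥N => f (z * ((p.1 : G) * (p.2 : G) * (p.1 : G)⁻¹)) := by
  haveI : CompactSpace ↥K := isCompact_iff_compactSpace.1 hK
  -- the compact set `S₁ = {k⁻¹ z⁻¹ g k}` and its trace on `N`
  obtain ⟨Ψ, hΨ⟩ : ∃ Ψ : ↥K × G → G, Ψ = fun q => ((q.1 : ↥K) : G)⁻¹ * (z⁻¹ * q.2) * ((q.1 : ↥K) : G) := ⟨_, rfl⟩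
  have hΨc : Continuous Ψ := by
    rw [hΨ]
    have h1 : Continuous fun q : ↥K × G => ((q.1 : ↥K) : G) := continuous_subtype_val.comp continuous_fst
    exact (h1.inv.mul (continuous_const.mul continuous_snd)).mul h1
  set S₁ : Set G := Ψ '' (univ ×ˢ tsupport f) with hS₁
  have hS₁c : IsCompact S₁ := (isCompact_univ.prod hfc).image hΨc
  set N₀ : Set ↥N := Subtype.val ⁻¹' S₁ with hN₀
  have hN₀c : IsCompact N₀ := hN.isClosedEmbedding_subtypeVal.isCompact_preimage hS₁c
  refine HasCompactSupport.intro (isCompact_univ.prod hN₀c) fun p hp => ?_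
  by_contra hne
  apply hp
  refine mk_mem_prod (mem_univ _) ?_
  change ((p.2 : ↥N) : G) ∈ S₁
  refine ⟨(p.1, z * ((p.1 : G) * (p.2 : G) * (p.1 : G)⁻¹)), mk_mem_prod (mem_univ _) (subset_tsupport _ hne), ?_⟩
  rw [hΨ]
  simp only
  group

variable [SecondCountableTopology G] [MeasurableSpace ↥K] [BorelSpace ↥K] [MeasurableSpace ↥N] [BorelSpace ↥N]
  (κ : Measure ↥K) (μN : Measure ↥N) [IsFiniteMeasureOnCompacts κ] [IsFiniteMeasureOnCompacts μN] [κ.IsOpenPosMeasure] [μN.IsOpenPosMeasure] [SFinite μN]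

include hK hN in
/-- **(N2b) THE `K × N` CONE INTEGRAL OF A NON-NEGATIVE FUNCTION IS POSITIVE**: for `K` compact, `N` closed, `κ`, `μ_N` finite on compacta and charging open sets, `z ∈ G` and
`f ≥ 0` continuous with compact support and `f z ≠ 0`: `0 < ∫_{K × N} f(z · k n k⁻¹) d(κ ⊗ μ_N)` (the integrand is continuous, non-negative, compactly supported, and equals
`f z > 0` at `(k, n) = (1, 1)`).  With `z = e^{iθ}·1` this is Rao's two-nappe cone value of ★ `tendsto_abs_sub_smul_integral_descConj_hypBlockGL`.
[cite: Varadarajan1989, §6.4 Thm 23] [cite: Shelstad1979, Lemma 4.3 p. 25] -/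
theorem integral_prod_conj_pos_of_nonneg (z : G) {f : G → ℝ} (hf : Continuous f) (hfc : HasCompactSupport f) (h0 : 0 ≤ f) (hz : f z ≠ 0) :
    0 < ∫ p : ↥K × ↥N, f (z * ((p.1 : G) * (p.2 : G) * (p.1 : G)⁻¹)) ∂(κ.prod μN) := by
  haveI : SecondCountableTopology ↥K := TopologicalSpace.Subtype.secondCountableTopology _
  haveI : SecondCountableTopology ↥N := TopologicalSpace.Subtype.secondCountableTopology _
  haveI : BorelSpace (↥K × ↥N) := Prod.borelSpace
  have hgc : Continuous fun p : ↥K × ↥N => f (z * ((p.1 : G) * (p.2 : G) * (p.1 : G)⁻¹)) := by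
    have h1 : Continuous fun p : ↥K × ↥N => ((p.1 : ↥K) : G) := continuous_subtype_val.comp continuous_fst
    have h2 : Continuous fun p : ↥K × ↥N => ((p.2 : ↥N) : G) := continuous_subtype_val.comp continuous_snd
    exact hf.comp (continuous_const.mul ((h1.mul h2).mul h1.inv))
  have hgs := hasCompactSupport_prod_conj K N hK hN z hfc
  refine integral_pos_of_integrable_nonneg_nonzero hgc (hgc.integrable_of_hasCompactSupport hgs) (fun p => h0 _) (x := ((1 : ↥K), (1 : ↥N))) ?_
  simpa only [OneMemClass.coe_one, mul_one, inv_one] using hz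

include hK hN in
/-- The `ℂ`-valued reading with a non-zero scalar: `C • ∫_{K × N} (f(z · k n k⁻¹) : ℂ) d(κ ⊗ μ_N) ≠ 0` for `C ≠ 0` — the `ℓ w₀ ≠ 0` input of ★ `stOrbFamH_insert_cayPt_ne_zero_of_prod` at
the wall place once (A0-b) docks. [cite: Varadarajan1989, §6.4 Thm 23] -/
theorem smul_integral_prod_conj_ofReal_ne_zero_of_nonneg {C : ℝ} (hC : C ≠ 0) (z : G) {f : G → ℝ} (hf : Continuous f) (hfc : HasCompactSupport f) (h0 : 0 ≤ f)
    (hz : f z ≠ 0) :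
    C • ∫ p : ↥K × ↥N, (((f (z * ((p.1 : G) * (p.2 : G) * (p.1 : G)⁻¹)) : ℝ) : ℂ)) ∂(κ.prod μN) ≠ 0 := by
  rw [integral_complex_ofReal, smul_ne_zero_iff]
  refine ⟨hC, ?_⟩
  rw [Complex.ofReal_ne_zero]
  exact (integral_prod_conj_pos_of_nonneg K N hK hN κ μN z hf hfc h0 hz).ne'

end Cone

/-! ## §4 (EDITION 2, append-only): the compact spectator factor -/

namespace UnitaryGroup

section CompactFactor

variable (L : Type) [Field L] [NumberField L] [IsCMField L] (S : Finset {w : InfinitePlace L // IsComplex w}) (w : {w : InfinitePlace L // IsComplex w})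
  [MeasurableSpace ↥(archLocal L 2 (Matrix.of fun i j : Fin 2 => if i.val + j.val + 1 = 2 then (1 : L) else 0) w)]
  [BorelSpace ↥(archLocal L 2 (Matrix.of fun i j : Fin 2 => if i.val + j.val + 1 = 2 then (1 : L) else 0) w)]
  (νw : Measure ↥(archLocal L 2 (Matrix.of fun i j : Fin 2 => if i.val + j.val + 1 = 2 then (1 : L) else 0) w))

omit [NumberField L] [IsCMField L] in
/-- **For `f ≥ 0` the local chart orbital functional is a NON-NEGATIVE REAL, unconditionally** (no continuity, support or measure hypothesis: the Bochner integral of a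
non-negative real function is `≥ 0`, and the box mass is `≥ 0`). [cite: Rogawski1990, §8.2 p. 122] -/
theorem chartOrbHLoc_ofReal_eq_ofReal_nonneg [IsFiniteMeasureOnCompacts νw] [νw.IsMulRightInvariant] (cw : Fin 3 → ℝ)
    {f : ↥(archLocal L 2 (Matrix.of fun i j : Fin 2 => if i.val + j.val + 1 = 2 then (1 : L) else 0) w) → ℝ} (h0 : 0 ≤ f) :
    ∃ r : ℝ, 0 ≤ r ∧ chartOrbHLoc L S w νw (fun x => ((f x : ℝ) : ℂ)) cw = (r : ℂ) := by
  letI : MeasurableSpace (↥(archLocal L 2 (Matrix.of fun i j : Fin 2 => if i.val + j.val + 1 = 2 then (1 : L) else 0) w) ⧸ chartTorusHLoc L S w) := borel _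
  refine ⟨(chartHaarHLoc L S w (chartBoxImgLoc L S w)).toReal *
      ∫ y, descConj (endoBlockAt L S w cw) (chartTorusHLoc L S w) (forall_mem_chartTorusHLoc_comm L S w cw) f y ∂(chartQuotientMeasureHLoc L S w νw),
    mul_nonneg ENNReal.toReal_nonneg (integral_nonneg fun y => ?_), ?_⟩
  · induction y using QuotientGroup.induction_on with
    | H g => exact h0 _
  · have hcomp : descConj (endoBlockAt L S w cw) (chartTorusHLoc L S w) (forall_mem_chartTorusHLoc_comm L S w cw) (fun x => ((f x : ℝ) : ℂ)) =
        fun y => ((descConj (endoBlockAt L S w cw) (chartTorusHLoc L S w) (forall_mem_chartTorusHLoc_comm L S w cw) f y : ℝ) : ℂ) := by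
      funext y
      induction y using QuotientGroup.induction_on with
      | H g => rfl
    rw [chartOrbHLoc_def, hcomp, integral_complex_ofReal, Complex.ofReal_mul]

/-- **(N2a), COMPACT SPECTATOR FACTOR** — the `ℓ w ≠ 0` input of ★ `stOrbFamH_insert_cayPt_ne_zero_of_prod` at a COMPACT place `w ∉ S` (local factor of
★ `archRH_mul_stableSum_eq_mul_prod`): at a regular compact local point (`e^{i cw 0} ≠ e^{i cw 2}`), for a Haar `ν_w` and `f ≥ 0` continuous whose orbital integrand at the chart
point has compact support and is positive at one conjugate, `(1 − e^{i(cw 2 − cw 0)}) · (chartOrbHLoc … f cw + chartOrbHLoc … f cw^flip) ≠ 0` (first summand `> 0`, second `≥ 0`,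
Shelstad's signed factor non-zero off the wall). [cite: Shelstad1979, §4 p. 22–23] [cite: Rogawski1990, §8.2 p. 122] -/
theorem compactFactor_chartOrbHLoc_ofReal_ne_zero_of_nonneg [νw.IsHaarMeasure] [νw.IsMulRightInvariant] (cw : Fin 3 → ℝ)
    (hreg : Circle.exp (cw 0) ≠ Circle.exp (cw 2))
    {f : ↥(archLocal L 2 (Matrix.of fun i j : Fin 2 => if i.val + j.val + 1 = 2 then (1 : L) else 0) w) → ℝ} (hf : Continuous f) (h0 : 0 ≤ f)
    (hsupp : HasCompactSupport (descConj (endoBlockAt L S w cw) (chartTorusHLoc L S w) (forall_mem_chartTorusHLoc_comm L S w cw) f))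
    {x₀ : ↥(archLocal L 2 (Matrix.of fun i j : Fin 2 => if i.val + j.val + 1 = 2 then (1 : L) else 0) w)} (hx : f (x₀ * endoBlockAt L S w cw * x₀⁻¹) ≠ 0) :
    (1 - (Circle.exp (cw 2 - cw 0) : ℂ)) *
        (chartOrbHLoc L S w νw (fun x => ((f x : ℝ) : ℂ)) cw + chartOrbHLoc L S w νw (fun x => ((f x : ℝ) : ℂ)) ![cw 2, cw 1, cw 0]) ≠ 0 := by
  obtain ⟨r₁, hr₁, h₁⟩ := chartOrbHLoc_ofReal_eq_ofReal_pos_of_nonneg L S w νw cw hf h0 hsupp hx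
  obtain ⟨r₂, hr₂, h₂⟩ := chartOrbHLoc_ofReal_eq_ofReal_nonneg L S w νw ![cw 2, cw 1, cw 0] h0
  refine mul_ne_zero ((ArchCartan.one_sub_coe_circleExp_sub_ne_zero_iff (cw 0) (cw 2)).2 hreg) ?_
  rw [h₁, h₂, ← Complex.ofReal_add, Complex.ofReal_ne_zero]
  exact (add_pos_of_pos_of_nonneg hr₁ hr₂).ne'

end CompactFactor

end UnitaryGroup

end Literature.NumberTheory.Automorphic

end
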